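import Summits.QuantumFields.YangMills.Theorems.VirialFluxGapRegularityCutoffDerivative
import Summits.QuantumFields.YangMills.Theorems.VirialFluxGapResolventFieldPointwise
import HarnessLib

/-!
# Route `VirialFluxGap` (YangMills): the MASS BRACKETS of the cross term as single-slot pairings — `Σ_j c_j·∂_j m_k = ∂_{Y_c} m_k = −(Re tr U_k/2)·Re tr(U_k·Y_c(w_k))`,
# and in quaternion letters `= −2·Re q_k·Re(q_k·p)` (`= 2·Re q_k·⟨Im q_k, Im p⟩` for a pure direction `p`)

Toward ⟨stmt-QuantumFields-24141⟩ `VirialFluxGap.PeriodicSoftness`.  The assembler's «CentralFieldPackage» (fcl-p3 g41, bus 02:43Z) asks in (P4) for ONE-SIDED bounds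
`−N√F ≤ Σ_va C_va(M)·∂_{fixFrameStd va} m_k(M)` on the mass brackets of the central field (and uses `|Σ_va (A⁻¹g)_va ∂_va m_k| ≤ A_G√t₀` for the generic
field); the signed cross term is ✓`cross_term_regCutoff_signed_le` (w2 g52).  This file reduces EVERY such bracket to one slot: by linearity of the frame
derivative (✓`frameD_dirOf`) and the explicit mass derivative (✓`frameD_linkMass` ∕ ✓`frameD_seamMass`),

* ★★ `sum_mul_frameD_linkMass` — `Σ_j c_j·∂_{τ_j} m_k(M) = −((Re tr U_k)/2 · Re tr(U_k · (dirOf τ c)(w_k)))`, `U_k = M.1 0 (wrapEdge k)`, `w_k = (0, wrapEdge k)`, for ANY finite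
  frame `τ` and ANY coefficients `c` (so for the central field the bracket only sees the direction `centralDir M w_k` at the wrap link, via
  ✓`dirOf_fixFrameStd_centralCoeff`); ★★ `sum_mul_frameD_seamMass` (seam root);
* ★ `re_trace_coe_mul_quatMatrix` — `Re tr(U·quatMatrix p) = 2·Re(su2Quat U · p)` for `U ∈ SU(2)` (✓`quatMatrix_su2Quat`, ✓`quatMatrix_mul`,
  ✓`su2_trace_re_eq_quat`), `re_mul_of_re_eq_zero` (`Re(q·p) = −⟨Im q, Im p⟩` for pure `p`);
* ★★★ `sum_mul_frameD_linkMass_quat` ∕ `_seamMass_quat` — at a ring history, if the direction at the wrap link ∕ seam root is `quatMatrix p` with `p` pure: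
  `Σ_j c_j·∂_{τ_j} m = 2·Re(q)·(q_I p_I + q_J p_J + q_K p_K)`, `q = su2Quat` of that link — the bracket in the quaternion letters of w3's explicit field
  (`p = Im(c̄q) + ½σz` at a wrap link: the `½σz` part gives `σRe(q)·⟨Im q, z⟩ ≥ 0` to leading order — LEAD's radial monotonicity).

HONEST FRAMING: algebra (theorems only, 0 `def`, 0 `sorry`, standard axioms); the bounds (P4) themselves, the central field's inequalities and the assembly are
NOT here; ⟨24141⟩ and ⟨22884⟩ stay OPEN; no stub ∕ crux ∕ rung ∕ summit is closed; the Yang–Mills mass gap is NOT proved; no summit is proved by a line.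
Width seat `ym-line-sfw-p2-w2` g52 (cell ym-idea-1, free hands), `--supports stmt-QuantumFields-24141`.  References: [cite: Luscher1983, §2]; [folklore].
-/

set_option autoImplicit false

noncomputable section

open scoped Matrix BigOperators ContDiff Topology Quaternion
open MeasureTheory
open Literature.MathematicalPhysics.QuantumFieldTheory hiding SU2
open Literature.MathematicalPhysics.QuantumLattice
open Literature.MathematicalPhysics.QuantumFieldTheory.SUNBakryEmery (expSU coe_expSU matTop)

namespace Summit.QuantumFields.YangMills.Theorems.VirialFluxGap.RegCutoff

open Summit.QuantumFields.YangMills.Theorems.FemtoTransferGap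
open Summit.QuantumFields.YangMills.Theorems.FemtoTransferGap.TT
open Summit.QuantumFields.YangMills.Theorems.VirialFluxGap.RingDeficit
open Summit.QuantumFields.YangMills.Theorems.VirialFluxGap.FrameDerivative
open Summit.QuantumFields.YangMills.Theorems.VirialFluxGap.FrameHessian

variable {L : ℕ} [NeZero L]
variable {ι : Type*} [Fintype ι]

open scoped Matrix.Norms.Frobenius

attribute [local instance 2000] Literature.MathematicalPhysics.QuantumFieldTheory.SUNBakryEmery.matTop

/-! ## §1 The brackets as single-slot pairings -/

/-- ★★ **The link-mass bracket of any coefficient family is a single-slot pairing**: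
`Σ_j c_j·∂_{τ_j} m_k(M) = −((Re tr U_k)/2 · Re tr(U_k · (dirOf τ c)(0, wrapEdge k)))`, `U_k = M.1 0 (wrapEdge k)`. [folklore] -/
theorem sum_mul_frameD_linkMass (τ : ι → ((Fin (2 * L - 1 + 1) × Edge 3 L) ⊕ Site 3 L) → Matrix (Fin 2) (Fin 2) ℂ) (c : ι → ℝ) (k : Fin 3)
    (M : (Fin (2 * L - 1 + 1) → Edge 3 L → Matrix (Fin 2) (Fin 2) ℂ) × (Site 3 L → Matrix (Fin 2) (Fin 2) ℂ)) :
    ∑ j, c j * frameD (τ j) (linkMass k) M =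
      -((((M.1 0 (wrapEdge k)).trace).re / 2) * (((M.1 0 (wrapEdge k) * dirOf τ c (Sum.inl (0, wrapEdge k))).trace).re)) := by
  rw [← frameD_dirOf τ c (linkMass k) M, frameD_linkMass]

/-- ★★ **The seam-mass bracket is a single-slot pairing**: `Σ_j c_j·∂_{τ_j} m_s(M) = −((Re tr V)/2 · Re tr(V · (dirOf τ c)(seam root)))`, `V = M.2 0`. [folklore] -/
theorem sum_mul_frameD_seamMass (τ : ι → ((Fin (2 * L - 1 + 1) × Edge 3 L) ⊕ Site 3 L) → Matrix (Fin 2) (Fin 2) ℂ) (c : ι → ℝ)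
    (M : (Fin (2 * L - 1 + 1) → Edge 3 L → Matrix (Fin 2) (Fin 2) ℂ) × (Site 3 L → Matrix (Fin 2) (Fin 2) ℂ)) :
    ∑ j, c j * frameD (τ j) seamMass M = -((((M.2 0).trace).re / 2) * (((M.2 0 * dirOf τ c (Sum.inr 0)).trace).re)) := by
  rw [← frameD_dirOf τ c seamMass M, frameD_seamMass]

/-! ## §2 Quaternion letters -/

omit [Fintype ι] in
/-- ★ `Re tr(U · quatMatrix p) = 2·Re(su2Quat U · p)` for `U ∈ SU(2)`. [folklore] -/
theorem re_trace_coe_mul_quatMatrix (U : SU2) (p : ℍ) :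
    (((U : Matrix (Fin 2) (Fin 2) ℂ) * quatMatrix p).trace).re = 2 * (su2Quat U * p).re := by
  rw [← quatMatrix_su2Quat U, ← quatMatrix_mul]
  rw [Matrix.trace_fin_two, quatMatrix_apply_00, quatMatrix_apply_11, Complex.add_re]
  ring

omit [NeZero L] [Fintype ι] in
/-- `Re(q·p) = −⟨Im q, Im p⟩` for a pure quaternion `p`. [folklore] -/
theorem re_mul_of_re_eq_zero (q : ℍ) {p : ℍ} (hp : p.re = 0) : (q * p).re = -(q.imI * p.imI + q.imJ * p.imJ + q.imK * p.imK) := by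
  rw [Quaternion.re_mul, hp]
  ring

/-- ★★★ **The link-mass bracket in quaternion letters**: at a ring history `P`, if the direction of the field at the slice-0 wrap link `k` is
`quatMatrix p` with `p` pure, then `Σ_j c_j·∂_{τ_j} m_k = 2·Re(q)·(q_I p_I + q_J p_J + q_K p_K)`, `q = su2Quat (P.1 0 (wrapEdge k))`. [cite: Luscher1983, §2] -/
theorem sum_mul_frameD_linkMass_quat (τ : ι → ((Fin (2 * L - 1 + 1) × Edge 3 L) ⊕ Site 3 L) → Matrix (Fin 2) (Fin 2) ℂ) (c : ι → ℝ) (k : Fin 3)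
    (P : (Fin (2 * L - 1 + 1) → GaugeConfig 3 L SU2) × (Site 3 L → SU2)) {p : ℍ} (hp : p.re = 0)
    (hdir : dirOf τ c (Sum.inl (0, wrapEdge k)) = quatMatrix p) :
    ∑ j, c j * frameD (τ j) (linkMass k) (ringCoord L P) =
      2 * (su2Quat (P.1 0 (wrapEdge k))).re *
        ((su2Quat (P.1 0 (wrapEdge k))).imI * p.imI + (su2Quat (P.1 0 (wrapEdge k))).imJ * p.imJ + (su2Quat (P.1 0 (wrapEdge k))).imK * p.imK) := by
  rw [sum_mul_frameD_linkMass, hdir]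
  have hU : (ringCoord L P).1 0 (wrapEdge k) = ((P.1 0 (wrapEdge k) : SU2) : Matrix (Fin 2) (Fin 2) ℂ) := rfl
  rw [hU, su2_trace_re_eq_quat, re_trace_coe_mul_quatMatrix, re_mul_of_re_eq_zero _ hp]
  ring

/-- ★★★ **The seam-mass bracket in quaternion letters**: `Σ_j c_j·∂_{τ_j} m_s = 2·Re(q)·⟨Im q, Im p⟩`, `q = su2Quat (P.2 0)`, direction `quatMatrix p` at the seam root,
`p` pure. [cite: Luscher1983, §2] -/
theorem sum_mul_frameD_seamMass_quat (τ : ι → ((Fin (2 * L - 1 + 1) × Edge 3 L) ⊕ Site 3 L) → Matrix (Fin 2) (Fin 2) ℂ) (c : ι → ℝ)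
    (P : (Fin (2 * L - 1 + 1) → GaugeConfig 3 L SU2) × (Site 3 L → SU2)) {p : ℍ} (hp : p.re = 0) (hdir : dirOf τ c (Sum.inr 0) = quatMatrix p) :
    ∑ j, c j * frameD (τ j) seamMass (ringCoord L P) =
      2 * (su2Quat (P.2 0)).re * ((su2Quat (P.2 0)).imI * p.imI + (su2Quat (P.2 0)).imJ * p.imJ + (su2Quat (P.2 0)).imK * p.imK) := by
  rw [sum_mul_frameD_seamMass, hdir]
  have hU : (ringCoord L P).2 0 = ((P.2 0 : SU2) : Matrix (Fin 2) (Fin 2) ℂ) := rfl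
  rw [hU, su2_trace_re_eq_quat, re_trace_coe_mul_quatMatrix, re_mul_of_re_eq_zero _ hp]
  ring

/-- The brackets VANISH for a family whose direction is `0` at the mass's slot (e.g. fields supported away from the four special slots). [folklore] -/
theorem sum_mul_frameD_linkMass_eq_zero (τ : ι → ((Fin (2 * L - 1 + 1) × Edge 3 L) ⊕ Site 3 L) → Matrix (Fin 2) (Fin 2) ℂ) (c : ι → ℝ) (k : Fin 3)
    (M : (Fin (2 * L - 1 + 1) → Edge 3 L → Matrix (Fin 2) (Fin 2) ℂ) × (Site 3 L → Matrix (Fin 2) (Fin 2) ℂ)) (hdir : dirOf τ c (Sum.inl (0, wrapEdge k)) = 0) :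
    ∑ j, c j * frameD (τ j) (linkMass k) M = 0 := by
  rw [sum_mul_frameD_linkMass, hdir, Matrix.mul_zero, Matrix.trace_zero, Complex.zero_re, mul_zero, neg_zero]

end Summit.QuantumFields.YangMills.Theorems.VirialFluxGap.RegCutoff

end
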